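import Summits.HodgeConjecture.FermatCycles.OpenCells
import HarnessLib

/-!
# The `(280, 4)` cell of the range extension `241 ≤ m ≤ 300`: a typed OPEN cell and its exact dependency on `(70, 4)`

HONEST FRAMING: explicit algebraic cycles for specific Hodge classes on Fermat/Delsarte varieties;
residual open instances listed; no claim on general Hodge.

Topic path `Summits/HodgeConjecture/FermatCycles/` of cell `pub-hfermat` (new work, not literature). Companion of `OpenCells.lean` (which is at the
400-line limit): the one grade-OPEN fourfold cell beyond `m = 240` found by the cell's range extension of 2026-08-20, stated as a typed `Prop`
asserting nothing, with the kernel-checked facts that make it the SAME question as `OpenCells.OpenCell_70_4`. See the section docstring for the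
provenance of the representative (lead's prediction + search-2's implementation; ENUM's two-implementation job P pending at filing).

References: [Aoki1987] N. Aoki, J. Math. Soc. Japan 39 (1987), Introduction p. 385 (claim(α)), §1 p. 388; [Shioda1979HodgeFermat] T. Shioda,
Math. Ann. 245 (1979) Thm I (1.6) (the Hodge criterion), Thm II / (2.3)–(2.4) of Aoki–Shioda for the level maps `xᵢ ↦ xᵢᵏ`.
-/

noncomputable section

open Finset
open Literature.AlgebraicGeometry.HodgeTheory Literature.AlgebraicGeometry.HodgeTheory.FermatCharacter
open Summit.HodgeConjecture.HodgeConjecture.Theorems.CancelByAnyClaimLattice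

namespace Summit.HodgeConjecture.FermatCycles.OpenCells

/-! ### `n = 4`, level `280`: the range extension `241 ≤ m ≤ 300` (ENUM job P; TARGETS v7 T7-5, lit-g12 2026-08-20)

The cell's n = 4 table was pushed from `m ≤ 240` to `m ≤ 300` on 2026-08-20 (ENUM job P, two implementations, submitted 15:00Z). The lead's
PREDICTION before the run (HOME/INBOX 15:05Z) — "grade-OPEN only `(280,4) = 4·α₇₀` (1 orbit) → EXIST CANCEL-35; `(297,4) = 9·β₃₃` → E4; no
first-open level" — was independently found by search-2's third implementation on all 60 levels (`pub-hfermat-search-2/compare/S2-N4-241-300.md`,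
INBOX 17:22Z: OPEN only at `(280,4) = (4,80,96,168,244,248) = x⁴·α₇₀`, 1 orbit / 24 multisets). When this block was filed, ENUM's own
two-implementation merge of job P had not yet landed; the successor lit seat re-reads `data/open_quotients.json` cell `280,4` and amends the
representative below if it differs (it is the pull-back of the `(70,4)` representative, so only a unit multiple could differ).

The point of the block is the DEPENDENCY, which is exact and needs no enumeration: `α₂₈₀` is the level-raised character `4·α₇₀`
(`alpha280_eq_levelRaise`), so under the sibling line's level-map stubs S2↑/S2↓ (pull-back / push-forward of claim along `xᵢ ↦ xᵢ⁴`, stated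
as hypotheses exactly as in `openCell_35_6_of_openCell_70_4`) the cells `(280,4)` and `(70,4)` are EQUIVALENT (`openCell_280_4_iff`): `(280,4)` is
not a new open class — it is `[ξ₃₅]` again (OPEN-CELLS §A2, `(70,4) ⇒ (35,6)` above). -/

/-- `α₂₈₀ = (4,80,96,168,244,248) = 4·α₇₀`: representative of the single grade-OPEN unit orbit of `(280,4)` (lead's prediction 15:05Z and search-2's
implementation 17:22Z; ENUM job P pending at filing — see the section docstring). [cite: Aoki1987, Introduction p. 385 (claim(α)) and §1 p. 388] -/
def alpha280 : Fin (2 * 2 + 2) → ZMod 280 := ![4, 80, 96, 168, 244, 248]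

/-- `α₂₈₀` is a Hodge character of `X⁴₂₈₀` (Shioda's criterion, kernel decision over the `96` units). [cite: Shioda1979HodgeFermat, Thm I (1.6)] -/
theorem isHodge_alpha280 : IsHodge alpha280 := by
  refine (isHodge_iff_isHodgeMultiset _).2 ?_
  unfold IsHodgeMultiset mNormSum alpha280
  decide +kernel

/-- `α₂₈₀` is the level-raised character `4·α₇₀` (pull-back along `xᵢ ↦ xᵢ⁴`, in the form used by the stubs S2↑/S2↓). [folklore] -/
theorem alpha280_eq_levelRaise : alpha280 = fun i ↦ (((4 * (D70.alpha70 i).val : ℕ) : ZMod (4 * 70))) := by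
  funext i; fin_cases i <;> decide

/-- `−α₂₈₀` is the level-raised character `4·(−α₇₀)`. [folklore] -/
theorem neg_alpha280_eq_levelRaise : -alpha280 = fun i ↦ (((4 * ((-D70.alpha70) i).val : ℕ) : ZMod (4 * 70))) := by
  funext i; fin_cases i <;> decide

/-- No entry of `±α₇₀` vanishes (hypothesis of the level-map stubs). [folklore] -/
theorem alpha70_ne_zero : (∀ i, D70.alpha70 i ≠ 0) ∧ ∀ i, (-D70.alpha70) i ≠ 0 := by
  unfold D70.alpha70; constructor <;> decide

/-- OPEN cell `(280,4)`: claim of `V(±α₂₈₀) ⊂ H⁴(X⁴₂₈₀)` — by `openCell_280_4_iff` the same question as `(70,4)` (class `[ξ₃₅]`); the cell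
settles it by the existence argument CANCEL-35 ← UNIRULED-70 (OPEN-CELLS §A2), with no explicit cycle. Nothing here asserts it.
[cite: Aoki1987, Introduction p. 385 (claim(α)) and §1 p. 388] -/
@[conjecture] def OpenCell_280_4 : Prop := Claim 280 2 alpha280 ∧ Claim 280 2 (-alpha280)

/-- **`(70,4)` gives `(280,4)`** by pull-back along `xᵢ ↦ xᵢ⁴` (stub S2↑ as a hypothesis, verbatim as in `openCell_35_6_of_openCell_70_4`).
[folklore assembly] -/
theorem openCell_280_4_of_openCell_70_4
    (hPull : ∀ (m k r : ℕ) (α' : Fin (2 * r + 2) → ZMod m), 0 < k → (∀ i, α' i ≠ 0) →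
      FermatCharacter.Claim m r α' → FermatCharacter.Claim (k * m) r (fun i => ((k * (α' i).val : ℕ) : ZMod (k * m))))
    (h : OpenCell_70_4) : OpenCell_280_4 := by
  refine ⟨?_, ?_⟩
  · have h1 := hPull 70 4 2 D70.alpha70 (by norm_num) alpha70_ne_zero.1 h.1
    rw [← alpha280_eq_levelRaise] at h1
    exact h1
  · have h2 := hPull 70 4 2 (-D70.alpha70) (by norm_num) alpha70_ne_zero.2 h.2
    rw [← neg_alpha280_eq_levelRaise] at h2
    exact h2

/-- **`(280,4)` gives back `(70,4)`** by push-forward along `xᵢ ↦ xᵢ⁴` (stub S2↓ as a hypothesis). [folklore assembly] -/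
theorem openCell_70_4_of_openCell_280_4
    (hPush : ∀ (m k r : ℕ) (α' : Fin (2 * r + 2) → ZMod m), 0 < k → (∀ i, α' i ≠ 0) →
      FermatCharacter.Claim (k * m) r (fun i => ((k * (α' i).val : ℕ) : ZMod (k * m))) → FermatCharacter.Claim m r α')
    (h : OpenCell_280_4) : OpenCell_70_4 := by
  refine ⟨hPush 70 4 2 D70.alpha70 (by norm_num) alpha70_ne_zero.1 ?_,
    hPush 70 4 2 (-D70.alpha70) (by norm_num) alpha70_ne_zero.2 ?_⟩
  · rw [← alpha280_eq_levelRaise]; exact h.1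
  · rw [← neg_alpha280_eq_levelRaise]; exact h.2

/-- **`(280,4) ⟺ (70,4)`** granted the two level-map stubs: the range extension to `m ≤ 300` adds no new open CLASS for fourfolds.
[folklore assembly] -/
theorem openCell_280_4_iff
    (hPull : ∀ (m k r : ℕ) (α' : Fin (2 * r + 2) → ZMod m), 0 < k → (∀ i, α' i ≠ 0) →
      FermatCharacter.Claim m r α' → FermatCharacter.Claim (k * m) r (fun i => ((k * (α' i).val : ℕ) : ZMod (k * m))))
    (hPush : ∀ (m k r : ℕ) (α' : Fin (2 * r + 2) → ZMod m), 0 < k → (∀ i, α' i ≠ 0) →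
      FermatCharacter.Claim (k * m) r (fun i => ((k * (α' i).val : ℕ) : ZMod (k * m))) → FermatCharacter.Claim m r α') :
    OpenCell_280_4 ↔ OpenCell_70_4 :=
  ⟨openCell_70_4_of_openCell_280_4 hPush, openCell_280_4_of_openCell_70_4 hPull⟩

end Summit.HodgeConjecture.FermatCycles.OpenCells

end
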